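import Literature.AlgebraicGeometry.AbelianSchemes.MumfordQuotientConstruction
import HarnessLib

/-!
# F-3 (M) child line `Cruxes/HDel/Lines/F3DualAbelianSchemeM` — stub (Mb) `stub_F3Mb` CLOSED: Mumford's construction
# `(A′⁄K′, π, 𝒫′)` over the split base `S′` with constant `K(L′)`

Summit `HodgeConjecture`, sub-problem `HodgeConjecture` (crux item `stmt-HodgeConjecture-24835`, HDel), namespace
`Summit.HodgeConjecture.CorCM.Cruxes.HypDel.F3DualAbelianSchemeM` (the registered child line's).  `stub_F3Mb_holds` is the letter of
`stub_F3Mb` (`Cruxes/HDel/Lines/F3DualAbelianSchemeM.lean`, child ed. 4) TOKEN FOR TOKEN, proved by ★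
`Literature.AlgebraicGeometry.AbelianSchemes.AbelianSchemeOver.exists_quotient_poincare_of_constant_kOfL_baseChange`
(road R of the (Mb) census: ★ `quotientBy` with its four raw hypotheses discharged — stable affine cover from projectivity
★ `Morphisms.exists_isAffineOpen_forall_mem_of_isProjective`, group law ∕ smoothness ∕ connected fibres ★ — , the normalised
`K′`-linearisation of Mumford's bundle ★ `MumfordBundleEquivariantStructure` over rigid descent along the unit section ★
`RigidDescentAlongUnitSectionOfBaseChange`, descent + rigidification ★ `MumfordQuotientPoincare`, kernel on all `T`-points and the
finset clause ★ `AbelianSchemeConstSubgroupQuotientPoints`).  Cell `hodgecm-mathlib` (D-0151); author B-p16 (g18).  HC_CM is proved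
only modulo the 7 printed citations until rung 0 closes; this file discharges none of them (it closes one registered stub of the
(M) child line of the F-3 sub-line of the P1 line under HDel).
-/

noncomputable section

open CategoryTheory CategoryTheory.Limits AlgebraicGeometry MonoidalCategory CartesianMonoidalCategory
open scoped MonObj
open Literature.AlgebraicGeometry.AbelianSchemes Literature.AlgebraicGeometry.RelativeSpec
  Literature.AlgebraicGeometry.Motives Literature.AlgebraicGeometry.AbelianVarieties Literature.AlgebraicGeometry.Modules
open Literature.AlgebraicGeometry.Morphisms (IsProjective)

namespace Summit.HodgeConjecture.CorCM.Cruxes.HypDel.F3DualAbelianSchemeM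

/-- **stub (Mb) `stub_F3Mb` PROVED** — [MumfordAV1970] §13 Theorem (p. 125), construction half, RELATIVE to the split affine base
`S′` (finite étale over the Noetherian `ℚ`-algebra `R`): for `A′ := A ×_R S′` projective, `L′ := L|_{A′}` rigidified, and a finite
`K′ ≤ A′(S′)`, pairwise distinct on geometric fibres, on which `K(L′)` is the constant functor, there are `hat := A′⁄K′`, the finite
étale surjective homomorphism `π : A′ → hat` with kernel `K(L′)` on all `T`-points, and a rank-one `𝒫′` on `A′ ×_{S′} hat`, rigidified
along `ε × 1`, fibrewise in `Pic⁰`, with `(1 × π)^*𝒫′ ≅ Λ(L′)`, and every finite set of points of `hat` in an affine open.  Statement =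
`stub_F3Mb` of the registered child line, token for token; proof = ★ `exists_quotient_poincare_of_constant_kOfL_baseChange` at
`k := ℚ` (`S′` is locally Noetherian: finite over `Spec R`, Mathlib `LocallyOfFiniteType.isLocallyNoetherian`).
[cite: MumfordAV1970, §13 Theorem (p. 125) and its proof] [cite: MumfordFogartyKirwan1994, Ch. 6 §1 Corollary 6.8 (p. 118) and §2 (p. 121)]
[cite: MilneAV2008, I §8 pp. 36–37] -/
theorem stub_F3Mb_holds : ∀ (R : Type) [CommRing R] [IsNoetherianRing R] [Algebra ℚ R] [ConnectedSpace ↥(Spec (.of R))]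
    (A : AbelianSchemeOver (Spec (.of R)))
    (L : A.left.Modules) (hL : HasRank L 1)
    (_hε : CechPic.pullback A.unitSection (detClass (HasRank.isFiniteLocallyFree' hL)) = 1)
    (_hΘ : ∀ ⦃Ω : Type⦄ [Field Ω] [IsAlgClosed Ω] (s : Spec (.of Ω) ⟶ Spec (.of R)),
      ∃ Θ : CartierDivisor (A.fibre s).toAbelianVariety.X.left, Θ.IsAmple ∧
        CechPic.pullback (X := (A.fibre s).toAbelianVariety.X.left) (pullback.fst A.X.hom s)
          (detClass (HasRank.isFiniteLocallyFree' hL)) = Θ.cechClass)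
    {S' : Scheme.{0}} [IsAffine S'] (p : S' ⟶ Spec (.of R)) [IsFinite p] [Etale p] [Surjective p]
    (_hA' : IsProjective (A.baseChange p).X.hom)
    (K' : Subgroup (A.baseChange p).Sections) [Finite K']
    (_hKinj : ∀ (Ω : Type) [Field Ω] [IsAlgClosed Ω] (s : Spec (.of Ω) ⟶ S') (σ : (A.baseChange p).Sections),
      σ ∈ K' → σ ≠ 1 → (A.baseChange p).restrict s σ ≠ (A.baseChange p).restrict s 1)
    (_hK' : ∀ (T : Over S') (u : T ⟶ (A.baseChange p).X),
      (A.baseChange p).MemKOfL ((Scheme.Modules.pullback (pullback.fst A.X.hom p)).obj L) u ↔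
        ∃ 𝒱 : Scheme.OpenCover.{0} T.left, ∀ j, ∃ σ : K',
          𝒱.f j ≫ u.left = 𝒱.f j ≫ T.hom ≫ (σ : (A.baseChange p).Sections).left),
    ∃ (hat : AbelianSchemeOver S') (π : (A.baseChange p).X ⟶ hat.X) (_ : IsMonHom π)
      (_ : IsFinite π.left) (_ : Etale π.left) (_ : Surjective π.left)
      (P : ((A.baseChange p).prodLeft hat).Modules),
      (∀ (T : Over S') (u : T ⟶ (A.baseChange p).X),
        u ≫ π = 1 ↔ (A.baseChange p).MemKOfL ((Scheme.Modules.pullback (pullback.fst A.X.hom p)).obj L) u) ∧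
      HasRank P 1 ∧
      Nonempty ((Scheme.Modules.pullback ((A.baseChange p).unitSlice hat)).obj P ≅ SheafOfModules.unit _) ∧
      (∀ (Ω : Type) [Field Ω] [IsAlgClosed Ω] (b : Spec (.of Ω) ⟶ hat.X.left),
        IsHomogeneous ((A.baseChange p).fibre (b ≫ hat.X.hom)).toAbelianVariety
          ((Scheme.Modules.pullback ((A.baseChange p).fibreSlice hat b)).obj P)) ∧
      Nonempty ((Scheme.Modules.pullback ((A.baseChange p).X ◁ π).left).obj P ≅
        (A.baseChange p).mumfordBundle ((Scheme.Modules.pullback (pullback.fst A.X.hom p)).obj L)) ∧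
      (∀ F : Finset hat.X.left, ∃ U : hat.X.left.Opens, IsAffineOpen U ∧ ∀ x ∈ F, x ∈ U) := by
  intro R _ _ _ _ A L hL hε _hΘ S' _ p _ _ _ hA' K' _ hKinj hK'
  haveI : IsLocallyNoetherian S' := LocallyOfFiniteType.isLocallyNoetherian p
  exact A.exists_quotient_poincare_of_constant_kOfL_baseChange
    (p ≫ Spec.map (CommRingCat.ofHom (algebraMap ℚ R))) hL hε p hA' K' hKinj hK'

end Summit.HodgeConjecture.CorCM.Cruxes.HypDel.F3DualAbelianSchemeM

end
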